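import Literature.AlgebraicTopology.SingularHomology.EilenbergSubcomplex
import Mathlib.Topology.CompactOpen
import HarnessLib

/-!
# Folding a homotopy rel `∂Δⁿ⁺¹` into one singular simplex of the Eilenberg subcomplex

Topic `Literature/AlgebraicTopology/SingularHomology`. A step of the Eilenberg-subcomplex proof
of the Hurewicz theorem (E. H. Spanier, *Algebraic Topology* (1981), Ch. 7 §5 (d), p. 397:
"`ψ′` is easily seen to be an inverse of `φ″`" — behind which lies: homotopic singular simplices
`(Δⁿ, Δ̇ⁿ) → (X, x₀)` have homologous classes `{σ}` in `Hₙ(Δ(X, {x₀}, x₀)ⁿ⁻¹, Δ(x₀))`;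
S. Eilenberg, *Singular homology theory*, Ann. of Math. 45 (1944), §32). Classically this is
done with the prism operator. Here we use instead a single `(n+2)`-simplex: given a homotopy
`H : I × Δⁿ⁺¹ → X` rel `∂Δⁿ⁺¹` from `g₀` to `g₁` (both, hence `H` at all times, equal to `x₀` on
`∂Δⁿ⁺¹`), the **folded simplex**

  `foldMap H : Δⁿ⁺² → X`,  `t ↦ H( tₙ₊₂ / (tₙ₊₁ + tₙ₊₂), (t₀, …, tₙ, tₙ₊₁ + tₙ₊₂) )`

(the degeneracy `sₙ₊₁` on the simplex factor, the ratio of the two merged coordinates as the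
time; the ratio is discontinuous only over `∂Δⁿ⁺¹`, where `H` does not depend on the time, so
`foldMap H` is continuous — a compact-open/tube-lemma argument, `continuous_foldFun`) has faces
`∂ₙ₊₂ = g₀`, `∂ₙ₊₁ = g₁` and all other faces constant (`foldMap_comp_stdFace_iBot`,
`foldMap_comp_stdFace_iTop`, `foldMap_comp_stdFace_castSucc_castSucc`), and sends the
codimension-two skeleton to `x₀` (`foldMap_apply_of_two_zero`), i.e. it is a simplex of
`Δ(X, {x₀}, x₀)ⁿ` (`foldMap_mem_eilenbergSimplices`).
Consequently (`exists_bd_add_zsmul_eq_sub_of_homotopyRel`): in the concrete singular chains,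

  `g₁ - g₀ = ∂w + k·cₙ₊₁`  for some chain `w` of `Δ(X, {x₀}, x₀)ⁿ` in degree `n + 2` and `k ∈ ℤ`,

`cₙ₊₁` the constant simplex — homotopic Eilenberg simplices are homologous in the Eilenberg
subcomplex modulo the chains of the point. Everything is PROVED; coefficients are arbitrary.

## References

* E. H. Spanier, *Algebraic Topology*, Springer 1981, Ch. 7 §5 (d) p. 397. [Spanier1981]
* A. Hatcher, *Algebraic Topology*, CUP 2002, §2.1, Thm. 2.10 (the prism operator this replaces).
  [HatcherAT2002]
-/

noncomputable section

open Set Function unitInterval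

universe u v

namespace Literature.AlgebraicTopology.SingularHomology

open SingularSimplex eilenbergSimplices

variable {X : Type u} [TopologicalSpace X] {x₀ : X} {n : ℕ}

/-! ### The folded simplex of a homotopy -/

section Fold

/-- The index `n + 1` of `Δⁿ⁺²` (the last-but-one coordinate). [folklore] -/
abbrev iTop (n : ℕ) : Fin (n + 3) := (Fin.last (n + 1)).castSucc

/-- The index `n + 2` of `Δⁿ⁺²` (the last coordinate). [folklore] -/
abbrev iBot (n : ℕ) : Fin (n + 3) := Fin.last (n + 2)

/-- `iTop ≠ iBot`. [folklore] -/
lemma iTop_ne_iBot (n : ℕ) : iTop n ≠ iBot n := (Fin.castSucc_lt_last _).ne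

/-- The simplex factor of the fold: merge the last two coordinates (the degeneracy `sₙ₊₁`),
`(t₀, …, tₙ, tₙ₊₁ + tₙ₊₂)`. [folklore] -/
def foldPtFun (t : StdSimplex (n + 2)) : Fin (n + 2) → ℝ := fun k =>
  (t : Fin (n + 3) → ℝ) k.castSucc + if k = Fin.last (n + 1) then (t : Fin (n + 3) → ℝ) (iBot n) else 0

/-- The merged point lies in `Δⁿ⁺¹`. [folklore] -/
lemma foldPtFun_mem (t : StdSimplex (n + 2)) : foldPtFun t ∈ stdSimplex ℝ (Fin (n + 2)) := by
  refine ⟨fun k => add_nonneg (t.2.1 _) ?_, ?_⟩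
  · split_ifs
    · exact t.2.1 _
    · exact le_rfl
  · have hsum : ∑ i, (t : Fin (n + 3) → ℝ) i = 1 := t.2.2
    rw [Fin.sum_univ_castSucc] at hsum
    simp only [foldPtFun, Finset.sum_add_distrib, Finset.sum_ite_eq', Finset.mem_univ, if_true]
    exact hsum

/-- The simplex factor of the fold as a continuous map `Δⁿ⁺² → Δⁿ⁺¹`. [folklore] -/
def foldPt : C(StdSimplex (n + 2), StdSimplex (n + 1)) where
  toFun t := ⟨foldPtFun t, foldPtFun_mem t⟩
  continuous_toFun := by
    refine Continuous.subtype_mk (continuous_pi fun k => ?_) _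
    refine ((continuous_apply _).comp continuous_subtype_val).add ?_
    split_ifs
    · exact (continuous_apply _).comp continuous_subtype_val
    · exact continuous_const

/-- Coordinates of `foldPt t` below the last one: `tₖ`. [folklore] -/
lemma foldPt_apply_castSucc (t : StdSimplex (n + 2)) (k : Fin (n + 1)) :
    (foldPt t : Fin (n + 2) → ℝ) k.castSucc = (t : Fin (n + 3) → ℝ) k.castSucc.castSucc := by
  change foldPtFun t k.castSucc = _
  rw [foldPtFun, if_neg (Fin.castSucc_lt_last k).ne, add_zero]

/-- The last coordinate of `foldPt t`: `tₙ₊₁ + tₙ₊₂`. [folklore] -/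
lemma foldPt_apply_last (t : StdSimplex (n + 2)) :
    (foldPt t : Fin (n + 2) → ℝ) (Fin.last (n + 1)) =
      (t : Fin (n + 3) → ℝ) (iTop n) + (t : Fin (n + 3) → ℝ) (iBot n) := by
  change foldPtFun t (Fin.last (n + 1)) = _
  rw [foldPtFun, if_pos rfl]

/-- If `tₖ = 0` for some `k ≤ n` then `foldPt t ∈ ∂Δⁿ⁺¹`. [folklore] -/
lemma foldPt_mem_stdBoundary_of_apply_castSucc_castSucc {t : StdSimplex (n + 2)} {k : Fin (n + 1)}
    (hk : (t : Fin (n + 3) → ℝ) k.castSucc.castSucc = 0) : foldPt t ∈ stdBoundary (n + 1) :=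
  ⟨k.castSucc, by rw [foldPt_apply_castSucc, hk]⟩

/-- If `tₙ₊₁ = tₙ₊₂ = 0` then `foldPt t ∈ ∂Δⁿ⁺¹`. [folklore] -/
lemma foldPt_mem_stdBoundary_of_apply_iTop_iBot {t : StdSimplex (n + 2)}
    (h1 : (t : Fin (n + 3) → ℝ) (iTop n) = 0) (h2 : (t : Fin (n + 3) → ℝ) (iBot n) = 0) :
    foldPt t ∈ stdBoundary (n + 1) :=
  ⟨Fin.last (n + 1), by rw [foldPt_apply_last, h1, h2, add_zero]⟩

/-- An index of `Fin (n + 3)` is `iTop`, `iBot`, or `k.castSucc.castSucc` for some `k : Fin (n+1)`.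
[folklore] -/
lemma fin_cases3 (i : Fin (n + 3)) : i = iTop n ∨ i = iBot n ∨ ∃ k : Fin (n + 1), i = k.castSucc.castSucc := by
  rcases Fin.eq_castSucc_or_eq_last i with ⟨j, rfl⟩ | rfl
  · rcases Fin.eq_castSucc_or_eq_last j with ⟨k, rfl⟩ | rfl
    · exact Or.inr (Or.inr ⟨k, rfl⟩)
    · exact Or.inl rfl
  · exact Or.inr (Or.inl rfl)

/-- **A point of `Δⁿ⁺²` with two vanishing coordinates folds into `∂Δⁿ⁺¹`** (so the folded simplex
of a homotopy rel `∂` kills the codimension-two skeleton). [folklore] -/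
lemma foldPt_mem_stdBoundary_of_two_zero {t : StdSimplex (n + 2)} {i l : Fin (n + 3)} (hil : i ≠ l)
    (hi : (t : Fin (n + 3) → ℝ) i = 0) (hl : (t : Fin (n + 3) → ℝ) l = 0) :
    foldPt t ∈ stdBoundary (n + 1) := by
  rcases fin_cases3 i with rfl | rfl | ⟨k, rfl⟩
  · rcases fin_cases3 l with rfl | rfl | ⟨k, rfl⟩
    · exact absurd rfl hil
    · exact foldPt_mem_stdBoundary_of_apply_iTop_iBot hi hl
    · exact foldPt_mem_stdBoundary_of_apply_castSucc_castSucc hl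
  · rcases fin_cases3 l with rfl | rfl | ⟨k, rfl⟩
    · exact foldPt_mem_stdBoundary_of_apply_iTop_iBot hl hi
    · exact absurd rfl hil
    · exact foldPt_mem_stdBoundary_of_apply_castSucc_castSucc hl
  · exact foldPt_mem_stdBoundary_of_apply_castSucc_castSucc hi

/-- The time factor of the fold: `tₙ₊₂ / (tₙ₊₁ + tₙ₊₂)`, clamped to `I` (the clamp is inactive),
with junk value `0` over `tₙ₊₁ = tₙ₊₂ = 0`. [folklore] -/
def foldTime (t : StdSimplex (n + 2)) : I :=
  Set.projIcc 0 1 zero_le_one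
    ((t : Fin (n + 3) → ℝ) (iBot n) / ((t : Fin (n + 3) → ℝ) (iTop n) + (t : Fin (n + 3) → ℝ) (iBot n)))

/-- The barycentric coordinates are continuous functions on the simplex. [folklore] -/
lemma continuous_coord {q : ℕ} (i : Fin (q + 1)) : Continuous fun t : StdSimplex q => (t : Fin (q + 1) → ℝ) i :=
  (continuous_apply i).comp continuous_subtype_val

/-- The denominator `tₙ₊₁ + tₙ₊₂` is continuous. [folklore] -/
lemma continuous_foldDen :
    Continuous fun t : StdSimplex (n + 2) => (t : Fin (n + 3) → ℝ) (iTop n) + (t : Fin (n + 3) → ℝ) (iBot n) :=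
  (continuous_coord (iTop n)).add (continuous_coord (iBot n))

/-- The numerator `tₙ₊₂` is continuous. [folklore] -/
lemma continuous_foldNum : Continuous fun t : StdSimplex (n + 2) => (t : Fin (n + 3) → ℝ) (iBot n) :=
  continuous_coord (iBot n)

/-- `foldTime` is continuous off the closed set `tₙ₊₁ + tₙ₊₂ = 0`. [folklore] -/
lemma continuousOn_foldTime :
    ContinuousOn (foldTime (n := n))
      {t | (t : Fin (n + 3) → ℝ) (iTop n) + (t : Fin (n + 3) → ℝ) (iBot n) ≠ 0} :=
  continuous_projIcc.comp_continuousOn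
    (continuous_foldNum.continuousOn.div continuous_foldDen.continuousOn fun _ ht => ht)

/-- With `tₙ₊₂ = 0` the time is `0`. [folklore] -/
lemma foldTime_of_apply_iBot {t : StdSimplex (n + 2)} (h : (t : Fin (n + 3) → ℝ) (iBot n) = 0) :
    foldTime t = 0 := by
  rw [foldTime, h, zero_div]
  exact Subtype.ext (by simp [Set.projIcc])

/-- With `tₙ₊₁ = 0 ≠ tₙ₊₂` the time is `1`. [folklore] -/
lemma foldTime_of_apply_iTop {t : StdSimplex (n + 2)} (h : (t : Fin (n + 3) → ℝ) (iTop n) = 0)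
    (h' : (t : Fin (n + 3) → ℝ) (iBot n) ≠ 0) : foldTime t = 1 := by
  rw [foldTime, h, zero_add, div_self h']
  exact Subtype.ext (by simp [Set.projIcc])

variable (H : C(I × StdSimplex (n + 1), X))

/-- The fold as a function: `t ↦ H (foldTime t, foldPt t)`. [folklore] -/
def foldFun (t : StdSimplex (n + 2)) : X := H (foldTime t, foldPt t)

/-- **Continuity of the fold** when `H` is constant `= x₀` over `∂Δⁿ⁺¹` at all times: at points
with `tₙ₊₁ + tₙ₊₂ ≠ 0` by composition; at the others `foldPt t ∈ ∂Δⁿ⁺¹`, and for a neighbourhood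
`V` of `x₀` the set of `z` with `H(I × {z}) ⊆ V` is open (tube lemma, via the compact-open
topology) and contains `∂Δⁿ⁺¹`. [folklore] -/
theorem continuous_foldFun (hH : ∀ (s : I), ∀ z ∈ stdBoundary (n + 1), H (s, z) = x₀) :
    Continuous (foldFun H) := by
  rw [continuous_iff_continuousAt]
  intro t
  by_cases ht : (t : Fin (n + 3) → ℝ) (iTop n) + (t : Fin (n + 3) → ℝ) (iBot n) ≠ 0
  · -- composition on the open set where the denominator is nonzero
    have hU : IsOpen {t : StdSimplex (n + 2) |
        (t : Fin (n + 3) → ℝ) (iTop n) + (t : Fin (n + 3) → ℝ) (iBot n) ≠ 0} :=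
      isOpen_ne_fun continuous_foldDen continuous_const
    have hc : ContinuousAt (foldTime (n := n)) t := (continuousOn_foldTime t ht).continuousAt (hU.mem_nhds ht)
    exact H.continuous.continuousAt.comp (hc.prodMk foldPt.continuous.continuousAt)
  · -- at a point over the boundary: tube lemma
    push Not at ht
    have ha : 0 ≤ (t : Fin (n + 3) → ℝ) (iTop n) := t.2.1 _
    have hb' : 0 ≤ (t : Fin (n + 3) → ℝ) (iBot n) := t.2.1 _
    have h1 : (t : Fin (n + 3) → ℝ) (iTop n) = 0 := by linarith
    have h2 : (t : Fin (n + 3) → ℝ) (iBot n) = 0 := by linarith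
    have hb : foldPt t ∈ stdBoundary (n + 1) := foldPt_mem_stdBoundary_of_apply_iTop_iBot h1 h2
    have hval : foldFun H t = x₀ := hH _ _ hb
    rw [ContinuousAt, hval, Filter.tendsto_def]
    intro V hV
    obtain ⟨V', hV'V, hV'o, hxV'⟩ := mem_nhds_iff.1 hV
    -- the curried homotopy `z ↦ H(·, z)` into the compact-open topology
    let K : C(StdSimplex (n + 1), C(I, X)) := (H.comp ContinuousMap.prodSwap).curry
    have hO : IsOpen {z : StdSimplex (n + 1) | MapsTo (K z) univ V'} :=
      (ContinuousMap.isOpen_setOf_mapsTo isCompact_univ hV'o).preimage K.continuous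
    have hzO : foldPt t ∈ {z : StdSimplex (n + 1) | MapsTo (K z) univ V'} := by
      intro s _
      change H (s, foldPt t) ∈ V'
      rw [hH s _ hb]
      exact hxV'
    have hpre : foldPt ⁻¹' {z : StdSimplex (n + 1) | MapsTo (K z) univ V'} ∈ nhds t :=
      (hO.preimage foldPt.continuous).mem_nhds hzO
    exact Filter.mem_of_superset hpre fun t' ht' => hV'V (ht' (mem_univ (foldTime t')))

/-- **The folded simplex of a homotopy rel `∂Δⁿ⁺¹`** as a continuous map `Δⁿ⁺² → X`. [folklore] -/
def foldMap (hH : ∀ (s : I), ∀ z ∈ stdBoundary (n + 1), H (s, z) = x₀) : C(StdSimplex (n + 2), X) :=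
  ⟨foldFun H, continuous_foldFun H hH⟩

variable {H}
variable (hH : ∀ (s : I), ∀ z ∈ stdBoundary (n + 1), H (s, z) = x₀)

/-- Unfolding of `foldMap`. [folklore] -/
lemma foldMap_apply (t : StdSimplex (n + 2)) : foldMap H hH t = H (foldTime t, foldPt t) := rfl

/-- `foldPt ∘ δₙ₊₂ = id`: inserting `0` last and merging the last two coordinates. [folklore] -/
lemma foldPt_stdFace_iBot (z : StdSimplex (n + 1)) : foldPt (stdFace (iBot n) z) = z := by
  ext k
  rcases Fin.eq_castSucc_or_eq_last k with ⟨k', rfl⟩ | rfl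
  · rw [foldPt_apply_castSucc]
    change (stdFace (Fin.last (n + 2)) z : Fin (n + 3) → ℝ) _ = _
    rw [← Fin.succAbove_last_apply, stdFace_apply_succAbove]
  · rw [foldPt_apply_last]
    change (stdFace (Fin.last (n + 2)) z : Fin (n + 3) → ℝ) (Fin.last (n + 1)).castSucc +
      (stdFace (Fin.last (n + 2)) z : Fin (n + 3) → ℝ) (Fin.last (n + 2)) = _
    rw [stdFace_apply_self, add_zero, ← Fin.succAbove_last_apply, stdFace_apply_succAbove]

/-- `foldPt ∘ δₙ₊₁ = id`: inserting `0` last-but-one and merging. [folklore] -/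
lemma foldPt_stdFace_iTop (z : StdSimplex (n + 1)) : foldPt (stdFace (iTop n) z) = z := by
  ext k
  rcases Fin.eq_castSucc_or_eq_last k with ⟨k', rfl⟩ | rfl
  · rw [foldPt_apply_castSucc]
    change (stdFace (Fin.last (n + 1)).castSucc z : Fin (n + 3) → ℝ) _ = _
    rw [← Fin.succAbove_castSucc_of_lt _ _ (Fin.castSucc_lt_last k'), stdFace_apply_succAbove]
  · rw [foldPt_apply_last]
    change (stdFace (Fin.last (n + 1)).castSucc z : Fin (n + 3) → ℝ) (Fin.last (n + 1)).castSucc +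
      (stdFace (Fin.last (n + 1)).castSucc z : Fin (n + 3) → ℝ) (Fin.last (n + 2)) = _
    rw [stdFace_apply_self, zero_add, show Fin.last (n + 2) = (Fin.last (n + 1)).succ from rfl,
      ← Fin.succAbove_castSucc_self, stdFace_apply_succAbove]

/-- **The last face of the fold is `g₀ = H(0, ·)`.** [folklore] -/
theorem foldMap_comp_stdFace_iBot :
    (foldMap H hH).comp (stdFace (iBot n)) = H.curry 0 := by
  ext z
  change H (foldTime (stdFace (iBot n) z), foldPt (stdFace (iBot n) z)) = H (0, z)
  rw [foldPt_stdFace_iBot, foldTime_of_apply_iBot (stdFace_apply_self _ z)]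

/-- **The last-but-one face of the fold is `g₁ = H(1, ·)`** (over `∂Δⁿ⁺¹`, where the time is junk,
`H` does not depend on it). [folklore] -/
theorem foldMap_comp_stdFace_iTop :
    (foldMap H hH).comp (stdFace (iTop n)) = H.curry 1 := by
  ext z
  change H (foldTime (stdFace (iTop n) z), foldPt (stdFace (iTop n) z)) = H (1, z)
  rw [foldPt_stdFace_iTop]
  by_cases hz : (z : Fin (n + 2) → ℝ) (Fin.last (n + 1)) = 0
  · have hb : z ∈ stdBoundary (n + 1) := ⟨_, hz⟩
    rw [hH _ _ hb, hH _ _ hb]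
  · rw [foldTime_of_apply_iTop (stdFace_apply_self _ z)]
    change (stdFace (Fin.last (n + 1)).castSucc z : Fin (n + 3) → ℝ) (Fin.last (n + 1)).succ ≠ 0
    rwa [← Fin.succAbove_castSucc_self, stdFace_apply_succAbove]

/-- **The other faces of the fold are constant**: for `k ≤ n`, `δₖ` inserts a zero among the first
`n + 1` coordinates, which survives the merging, so the folded point is in `∂Δⁿ⁺¹`. [folklore] -/
theorem foldMap_comp_stdFace_castSucc_castSucc (k : Fin (n + 1)) :
    (foldMap H hH).comp (stdFace k.castSucc.castSucc) = ContinuousMap.const _ x₀ := by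
  ext z
  change H (foldTime _, foldPt (stdFace k.castSucc.castSucc z)) = x₀
  exact hH _ _ (foldPt_mem_stdBoundary_of_apply_castSucc_castSucc (stdFace_apply_self _ z))

/-- **The fold sends the codimension-two skeleton `(Δⁿ⁺²)ⁿ` to `x₀`**, hence is a simplex of
`Δ(X, {x₀}, x₀)ⁿ`. [folklore] -/
theorem foldMap_apply_of_two_zero {t : StdSimplex (n + 2)} {i l : Fin (n + 3)} (hil : i ≠ l)
    (hi : (t : Fin (n + 3) → ℝ) i = 0) (hl : (t : Fin (n + 3) → ℝ) l = 0) : foldMap H hH t = x₀ :=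
  hH _ _ (foldPt_mem_stdBoundary_of_two_zero hil hi hl)

end Fold

/-! ### Points of a skeleton have many vanishing coordinates -/

/-- A point of the `k`-skeleton of `Δ^q` with `k + 2 ≤ q` has two distinct vanishing coordinates.
[folklore] -/
lemma exists_two_zero_of_mem_stdSkel {q k : ℕ} (h : k + 2 ≤ q) {t : StdSimplex q} (ht : t ∈ stdSkel q k) :
    ∃ i l : Fin (q + 1), i ≠ l ∧ (t : Fin (q + 1) → ℝ) i = 0 ∧ (t : Fin (q + 1) → ℝ) l = 0 := by
  rw [mem_stdSkel_iff] at ht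
  have hc : 1 < ((StdSimplex.nzCoords t)ᶜ).card := by
    rw [Finset.card_compl, Fintype.card_fin]
    omega
  obtain ⟨i, hi, l, hl, hil⟩ := Finset.one_lt_card.1 hc
  rw [Finset.mem_compl, StdSimplex.mem_nzCoords, not_not] at hi hl
  exact ⟨i, l, hil, hi, hl⟩

/-- The folded simplex of a homotopy rel `∂Δⁿ⁺¹` is an Eilenberg simplex of `Δ(X, {x₀}, x₀)ⁿ`.
[folklore] -/
lemma foldMap_mem_eilenbergSimplices (H : C(I × StdSimplex (n + 1), X))
    (hH : ∀ (s : I), ∀ z ∈ stdBoundary (n + 1), H (s, z) = x₀) :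
    ofMap (foldMap H hH) ∈ eilenbergSimplices X x₀ n (n + 2) := by
  refine ofMap_mem fun t ht => ?_
  obtain ⟨i, l, hil, hi, hl⟩ := exists_two_zero_of_mem_stdSkel (by omega) ht
  exact foldMap_apply_of_two_zero hH hil hi hl

/-! ### Homotopic Eilenberg simplices are homologous modulo the point -/

section Chains

variable (R : Type v) [CommRing R] (M : Type v) [AddCommGroup M] [Module R M]

/-- The alternating sum `∑_{j ≤ n} (-1)ʲ m • c` over the first `n + 1` faces is an integer
multiple of `c`. [folklore] -/
lemma sum_neg_one_pow_smul_eq_zsmul {A : Type*} [AddCommGroup A] [Module R A] (q : ℕ) (c : A) :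
    ∃ k : ℤ, ∑ j : Fin q, ((-1 : R) ^ (j : ℕ)) • c = k • c := by
  refine ⟨∑ j : Fin q, (-1 : ℤ) ^ (j : ℕ), ?_⟩
  rw [Finset.sum_smul]
  refine Finset.sum_congr rfl fun j _ => ?_
  rw [← Int.cast_smul_eq_zsmul R, Int.cast_pow, Int.cast_neg, Int.cast_one]

/-- **Homotopic Eilenberg simplices differ by a boundary of the Eilenberg subcomplex plus a multiple
of the constant simplex.** If `H : I × Δⁿ⁺¹ → X` is constant `= x₀` over `∂Δⁿ⁺¹`, then in the
concrete singular chains `H(1, ·) - H(0, ·) = ∂w + k • cₙ₊₁` with `w` a chain of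
`Δ(X, {x₀}, x₀)ⁿ` in degree `n + 2` (a multiple of the folded simplex) and `k ∈ ℤ` (Spanier 1981,
Ch. 7 §5 (d): homotopic `σ`'s have the same class `{σ}` modulo the point). [cite: Spanier1981, Ch. 7 §5 p. 397] -/
theorem exists_bd_add_zsmul_eq_sub_of_homotopy (H : C(I × StdSimplex (n + 1), X))
    (hH : ∀ (s : I), ∀ z ∈ stdBoundary (n + 1), H (s, z) = x₀) (m : M) :
    ∃ (w : CChain M X (n + 2)) (k : ℤ), w ∈ eilenbergChains R M X x₀ n (n + 2) ∧
      Finsupp.single (ofMap (H.curry 1)) m - Finsupp.single (ofMap (H.curry 0)) m =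
        csingularChainComplex.bd R (n + 1) w + k • Finsupp.single (constAt x₀ (n + 1)) m := by
  set W : SingularSimplex X (n + 2) := ofMap (foldMap H hH) with hW
  -- the faces of `W`
  have hface_bot : W.face (iBot n) = ofMap (H.curry 0) := by
    rw [hW, ofMap_face, foldMap_comp_stdFace_iBot]
  have hface_top : W.face (iTop n) = ofMap (H.curry 1) := by
    rw [hW, ofMap_face, foldMap_comp_stdFace_iTop]
  have hface_lo : ∀ k : Fin (n + 1), W.face k.castSucc.castSucc = constAt x₀ (n + 1) := fun k => by
    rw [hW, ofMap_face, foldMap_comp_stdFace_castSucc_castSucc]; rfl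
  -- `∂W = (∑_{k ≤ n} (-1)ᵏ) c + (-1)ⁿ⁺¹ g₁ + (-1)ⁿ⁺² g₀`
  have hbd : csingularChainComplex.bd R (n + 1) (Finsupp.single W m) =
      (∑ k : Fin (n + 1), ((-1 : R) ^ (k : ℕ)) • Finsupp.single (constAt x₀ (n + 1)) m) +
        ((-1 : R) ^ (n + 1)) • Finsupp.single (ofMap (H.curry 1)) m +
        ((-1 : R) ^ (n + 2)) • Finsupp.single (ofMap (H.curry 0)) m := by
    rw [csingularChainComplex.bd_single, Fin.sum_univ_castSucc, Fin.sum_univ_castSucc]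
    simp only [Fin.val_castSucc, Fin.val_last, hface_lo, hface_top, hface_bot]
  obtain ⟨k₀, hk₀⟩ := sum_neg_one_pow_smul_eq_zsmul R (n + 1) (Finsupp.single (constAt x₀ (n + 1)) m)
  rw [hk₀] at hbd
  -- solve for `g₁ - g₀`
  have hsq : ((-1 : R) ^ (n + 1)) * ((-1 : R) ^ (n + 1)) = 1 := by
    rw [← pow_add, ← two_mul, pow_mul, neg_one_sq, one_pow]
  have hsq' : ((-1 : R) ^ (n + 1)) * ((-1 : R) ^ (n + 2)) = -1 := by
    rw [pow_succ (-1 : R) (n + 1), ← mul_assoc, hsq, one_mul]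
  refine ⟨((-1 : R) ^ (n + 1)) • Finsupp.single W m, -((-1 : ℤ) ^ (n + 1) * k₀), ?_, ?_⟩
  · exact Submodule.smul_mem _ _ (single_mem_eilenbergChains R M (foldMap_mem_eilenbergSimplices H hH) m)
  · rw [map_smul, hbd, smul_add, smul_add, smul_smul, smul_smul, hsq, hsq', one_smul, neg_one_smul]
    have hK : (-((-1 : ℤ) ^ (n + 1) * k₀)) • Finsupp.single (constAt x₀ (n + 1)) m =
        -(((-1 : R) ^ (n + 1)) • (k₀ • Finsupp.single (constAt x₀ (n + 1)) m)) := by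
      rw [neg_smul, mul_smul, ← Int.cast_smul_eq_zsmul R ((-1 : ℤ) ^ (n + 1)), Int.cast_pow,
        Int.cast_neg, Int.cast_one]
    rw [hK]
    abel

/-- **Maps homotopic rel `∂Δⁿ⁺¹` give Eilenberg simplices that are homologous in the Eilenberg
subcomplex modulo the point**: `g₁ - g₀ = ∂w + k • cₙ₊₁` (the form consumed by the Hurewicz
argument, from a Mathlib `HomotopyRel`). [cite: Spanier1981, Ch. 7 §5 p. 397] -/
theorem exists_bd_add_zsmul_eq_sub_of_homotopyRel {g₀ g₁ : C(StdSimplex (n + 1), X)}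
    (F : g₀.HomotopyRel g₁ (stdBoundary (n + 1))) (hg₀ : ∀ z ∈ stdBoundary (n + 1), g₀ z = x₀) (m : M) :
    ∃ (w : CChain M X (n + 2)) (k : ℤ), w ∈ eilenbergChains R M X x₀ n (n + 2) ∧
      Finsupp.single (ofMap g₁) m - Finsupp.single (ofMap g₀) m =
        csingularChainComplex.bd R (n + 1) w + k • Finsupp.single (constAt x₀ (n + 1)) m := by
  have hH : ∀ (s : I), ∀ z ∈ stdBoundary (n + 1), (F : C(I × StdSimplex (n + 1), X)) (s, z) = x₀ :=
    fun s z hz => (F.prop s z hz).trans (hg₀ z hz)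
  obtain ⟨w, k, hw, h⟩ := exists_bd_add_zsmul_eq_sub_of_homotopy R M (F : C(I × StdSimplex (n + 1), X)) hH m
  refine ⟨w, k, hw, ?_⟩
  have h1 : (F : C(I × StdSimplex (n + 1), X)).curry 1 = g₁ := by ext z; exact F.apply_one z
  have h0 : (F : C(I × StdSimplex (n + 1), X)).curry 0 = g₀ := by ext z; exact F.apply_zero z
  rw [h1, h0] at h
  exact h

end Chains

end Literature.AlgebraicTopology.SingularHomology

end
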